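import Mathlib
import HarnessLib
import Summits.NavierStokesRegularity.NavierStokesRegularity.Theorems.PoloidalWindowDoorLrcModEntireCurvedWebHuygens
import Summits.NavierStokesRegularity.NavierStokesRegularity.Theorems.PoloidalWindowDoorLrcModEntireGraphTransportRigidity

/-!
# Route `PoloidalWindowDoor`, item `LrcModEntire` (stmt-NavierStokesRegularity-20428), cell (Q4-sonic, straight, μ < 0) `stub_Q4sonicLineNeg`, case II —
# BRICK B-TWPc, PART T1: THE BASE WEB AT A GENERAL TIME, RE-PARAMETRISED BY ARCLENGTH (unit-speed branch, Frenet law, graph curvature)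

Cell ns-regularity-ideate, stub-worker seat ns-poloidal-K2-p2 g18 under the LEAD of item 20428 (ns-poloidal-K2-p3 g17/g18);
`--supports stmt-NavierStokesRegularity-20428 --as helper`.  Memo `Cruxes/LrcModEntire/TOWER-CLOSES-port2g9.md` §D2/§E (B-TWPc = «the curved time-web package at a
general base time»; LEAD 2026-08-29T23:13:57Z revised v15: close `stub_Q4sonicLineNegIsolated` BY NAME through the curved END at ONE small non-sonic time `τ₁`).
At time `−1+τ₁` the base web of the case-II object is the GRAPH `s ↦ s·e + g(s)·Je` (`g = n₀(τ₁,·,0)`, the space–time web function over the straight hot line); every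
Fermi-frame brick of the tower (this seat's `…CurvedWebHuygens/…CurvedParallelWebs/…CurvedSheetTransport`, port-2 g9's `…CurvedSheetCR/Jet/SpeedLaw/TimeSplit`) wants a
UNIT-SPEED horizontal branch `Γ` with a Frenet law `Γ″ = k·JΓ′`.  This file supplies it (class-free; `g : ℝ → ℝ` any `C^∞` function, `e` a horizontal unit vector):

* speed and arclength — `v = √(1 + g′²) ≥ 1`, `ℓ(s) = ∫₀ˢ v` (`C^∞`, `ℓ′ = v`, strictly increasing, onto `ℝ`; written out, no definitions);
* ★ `exists_unitSpeed_graph` — a `C^∞` strictly increasing bijection `φ : ℝ → ℝ` (`φ = ℓ⁻¹`, `φ 0 = 0`, `φ′ = 1/v∘φ > 0`) and the unit-speed branch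
  `Γ σ = φ σ·e + g(φ σ)·Je`: `C^∞`, horizontal, `‖Γ′‖ = 1`, FRENET LAW `Γ″ = k·rotJ Γ′` with the GRAPH CURVATURE `k σ = g″(φσ)/v(φσ)³` (`C^∞`), and
  `Γ′ σ = (1/v(φσ))·(e + g′(φσ)·Je)`;
* `graph_pinned_of_curvature_zero` — if `k ≡ 0` and `|g| ≤ r` on `ℝ` then `g` is constant (`g″ ≡ 0` ⇒ affine ⇒ bounded-affine ⇒ constant,
  `…GraphTransportRigidity.eq_zero_of_affine_bounded`): the endgame «`k′ ≡ 0` ⇒ … ⇒ the base web is `e`-parallel (pinned)» of TOWER-CLOSES §D2 in the `k ≡ 0` branch.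

WHAT THIS IS NOT: not a claim about Navier–Stokes regularity; class-free calculus for the research residue `stub_Q4sonicLineNegIsolated`
(bears_on LADDER-NS N0 via item 20428; items 20428 / 19708 / 27893 OPEN).
-/

noncomputable section

set_option linter.dupNamespace false
set_option linter.style.longLine false

namespace Summit.NavierStokesRegularity.NavierStokesRegularity.Theorems.PoloidalWindowDoorLrcModEntireBaseWebArclength

open Set Function Filter Topology MeasureTheory intervalIntegral
open scoped RealInnerProductSpace InnerProductSpace ContDiff
open Summit.NavierStokesRegularity.NavierStokesRegularity.Theorems.PoloidalWindowDoorLrcModEntireSheetFlattenTools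
open Summit.NavierStokesRegularity.NavierStokesRegularity.Theorems.PoloidalWindowDoorLrcModEntireRidgeGlobalBranchODE
open Summit.NavierStokesRegularity.NavierStokesRegularity.Theorems.PoloidalWindowDoorLrcModEntireRidgeGlobalBranchFrame
open Summit.NavierStokesRegularity.NavierStokesRegularity.Theorems.PoloidalWindowDoorLrcModEntireCurvedWebHuygens
open Summit.NavierStokesRegularity.NavierStokesRegularity.Theorems.PoloidalWindowDoorLrcModEntireGraphTransportRigidity

variable {g : ℝ → ℝ}

/-! ### 1. Speed and arclength of the graph `s ↦ s·e + g(s)·Je` -/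

/-! Throughout, the SPEED is `v(s) = √(1 + g′(s)²)` and the ARCLENGTH is `ℓ(s) = ∫₀ˢ v` (written out; no definitions are introduced). -/

/-- `1 + g′² > 0`. -/
theorem one_add_sq_pos (s : ℝ) : 0 < 1 + deriv g s ^ 2 := by positivity

/-- `v ≥ 1`. -/
theorem one_le_speed (s : ℝ) : 1 ≤ Real.sqrt (1 + deriv g s ^ 2) := by
  calc (1 : ℝ) = Real.sqrt 1 := by simp
    _ ≤ Real.sqrt (1 + deriv g s ^ 2) := Real.sqrt_le_sqrt (by nlinarith [sq_nonneg (deriv g s)])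

/-- `v > 0`. -/
theorem speed_pos (s : ℝ) : 0 < Real.sqrt (1 + deriv g s ^ 2) := lt_of_lt_of_le one_pos (one_le_speed s)

/-- `v² = 1 + g′²`. -/
theorem speed_sq (s : ℝ) : Real.sqrt (1 + deriv g s ^ 2) ^ 2 = 1 + deriv g s ^ 2 := by
  rw [Real.sq_sqrt (one_add_sq_pos s).le]

/-- `v` is `C^∞` when `g` is. -/
theorem contDiff_speed (hg : ContDiff ℝ ∞ g) : ContDiff ℝ ∞ (fun s => Real.sqrt (1 + deriv g s ^ 2)) := by
  have h1 : ContDiff ℝ ∞ (deriv g) := (contDiff_infty_iff_deriv.1 hg).2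
  have h2 : ContDiff ℝ ∞ (fun s => 1 + deriv g s ^ 2) := contDiff_const.add (h1.pow 2)
  exact h2.sqrt fun s => (one_add_sq_pos s).ne'

/-- `ℓ′ = v`. -/
theorem hasDerivAt_arclen (hg : ContDiff ℝ ∞ g) (s : ℝ) : HasDerivAt (fun s => ∫ t in (0 : ℝ)..s, Real.sqrt (1 + deriv g t ^ 2)) (Real.sqrt (1 + deriv g s ^ 2)) s :=
  ((contDiff_speed hg).continuous.integral_hasStrictDerivAt 0 s).hasDerivAt

/-- `deriv ℓ = v`. -/
theorem deriv_arclen (hg : ContDiff ℝ ∞ g) : deriv (fun s => ∫ t in (0 : ℝ)..s, Real.sqrt (1 + deriv g t ^ 2)) = fun s => Real.sqrt (1 + deriv g s ^ 2) := funext fun s => (hasDerivAt_arclen hg s).deriv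

/-- `ℓ` is `C^∞`. -/
theorem contDiff_arclen (hg : ContDiff ℝ ∞ g) : ContDiff ℝ ∞ (fun s => ∫ t in (0 : ℝ)..s, Real.sqrt (1 + deriv g t ^ 2)) := by
  rw [contDiff_infty_iff_deriv]
  exact ⟨fun s => (hasDerivAt_arclen hg s).differentiableAt, by rw [deriv_arclen hg]; exact contDiff_speed hg⟩

/-- `ℓ 0 = 0`. -/
theorem arclen_zero : (∫ t in (0 : ℝ)..0, Real.sqrt (1 + deriv g t ^ 2)) = 0 := by simp

/-- `ℓ` is strictly increasing. -/
theorem strictMono_arclen (hg : ContDiff ℝ ∞ g) : StrictMono (fun s => ∫ t in (0 : ℝ)..s, Real.sqrt (1 + deriv g t ^ 2)) :=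
  strictMono_of_deriv_pos fun s => by rw [deriv_arclen hg]; exact speed_pos s

/-- `ℓ(s) − s` is monotone (its derivative `v − 1 ≥ 0`), whence `ℓ s ≥ s` for `s ≥ 0` and `ℓ s ≤ s` for `s ≤ 0`. -/
theorem monotone_arclen_sub_id (hg : ContDiff ℝ ∞ g) : Monotone fun s => (∫ t in (0 : ℝ)..s, Real.sqrt (1 + deriv g t ^ 2)) - s := by
  have hds : ∀ s, HasDerivAt (fun s => (∫ t in (0 : ℝ)..s, Real.sqrt (1 + deriv g t ^ 2)) - s) (Real.sqrt (1 + deriv g s ^ 2) - 1) s := fun s =>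
    (hasDerivAt_arclen hg s).sub (hasDerivAt_id s)
  have hd : Differentiable ℝ fun s => (∫ t in (0 : ℝ)..s, Real.sqrt (1 + deriv g t ^ 2)) - s := fun s => (hds s).differentiableAt
  refine monotone_of_deriv_nonneg hd fun s => ?_
  rw [(hds s).deriv]
  linarith [one_le_speed (g := g) s]

/-- `ℓ` is onto `ℝ`. -/
theorem surjective_arclen (hg : ContDiff ℝ ∞ g) : Surjective (fun s => ∫ t in (0 : ℝ)..s, Real.sqrt (1 + deriv g t ^ 2)) := by
  have hc : Continuous (fun s => ∫ t in (0 : ℝ)..s, Real.sqrt (1 + deriv g t ^ 2)) := (contDiff_arclen hg).continuous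
  have hm := monotone_arclen_sub_id hg
  have h0 : (∫ t in (0 : ℝ)..0, Real.sqrt (1 + deriv g t ^ 2)) - 0 = 0 := by simp
  refine hc.surjective ?_ ?_
  · refine tendsto_atTop_mono' atTop ?_ tendsto_id
    filter_upwards [eventually_ge_atTop (0 : ℝ)] with s hs
    have := hm hs; simp only [h0] at this
    show s ≤ (∫ t in (0 : ℝ)..s, Real.sqrt (1 + deriv g t ^ 2))
    linarith
  · refine tendsto_atBot_mono' atBot ?_ tendsto_id
    filter_upwards [eventually_le_atBot (0 : ℝ)] with s hs
    have := hm hs; simp only [h0] at this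
    show (∫ t in (0 : ℝ)..s, Real.sqrt (1 + deriv g t ^ 2)) ≤ s
    linarith

/-! ### 2. The inverse arclength `φ = ℓ⁻¹` -/

/-- ★ **The inverse arclength**: a `C^∞` strictly increasing bijection `φ : ℝ → ℝ` with `ℓ (φ σ) = σ`, `φ (ℓ s) = s`, `φ 0 = 0`, `φ′ σ = 1 / v(φ σ) > 0`. -/
theorem exists_arclen_inverse (hg : ContDiff ℝ ∞ g) :
    ∃ φ : ℝ → ℝ, ContDiff ℝ ∞ φ ∧ StrictMono φ ∧ Surjective φ ∧ (∀ σ, (∫ t in (0 : ℝ)..(φ σ), Real.sqrt (1 + deriv g t ^ 2)) = σ) ∧ (∀ s, φ ((∫ t in (0 : ℝ)..s, Real.sqrt (1 + deriv g t ^ 2))) = s) ∧ φ 0 = 0 ∧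
      (∀ σ, HasDerivAt φ (1 / Real.sqrt (1 + deriv g (φ σ) ^ 2)) σ) := by
  set L : ℝ ≃o ℝ := StrictMono.orderIsoOfSurjective (fun s => ∫ t in (0 : ℝ)..s, Real.sqrt (1 + deriv g t ^ 2)) (strictMono_arclen hg) (surjective_arclen hg) with hL
  have hLapp : ∀ s, L s = (∫ t in (0 : ℝ)..s, Real.sqrt (1 + deriv g t ^ 2)) := fun s => by rw [hL, StrictMono.coe_orderIsoOfSurjective]
  set H : ℝ ≃ₜ ℝ := L.toHomeomorph with hH
  have hHapp : ∀ s, H s = (∫ t in (0 : ℝ)..s, Real.sqrt (1 + deriv g t ^ 2)) := fun s => by rw [hH]; simp [hLapp]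
  have hHfun : (H : ℝ → ℝ) = (fun s => ∫ t in (0 : ℝ)..s, Real.sqrt (1 + deriv g t ^ 2)) := funext hHapp
  set φ : ℝ → ℝ := ⇑H.symm with hφ
  have hφL : ∀ σ, (∫ t in (0 : ℝ)..(φ σ), Real.sqrt (1 + deriv g t ^ 2)) = σ := fun σ => by rw [← hHapp]; exact H.apply_symm_apply σ
  have hLφ : ∀ s, φ ((∫ t in (0 : ℝ)..s, Real.sqrt (1 + deriv g t ^ 2))) = s := fun s => by rw [← hHapp]; exact H.symm_apply_apply s
  have hφcd : ContDiff ℝ ∞ φ := by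
    have h := H.contDiff_symm_deriv (f' := fun s => Real.sqrt (1 + deriv g s ^ 2)) (fun s => (speed_pos s).ne') (fun s => by rw [hHfun]; exact hasDerivAt_arclen hg s)
      (by rw [hHfun]; exact contDiff_arclen hg)
    exact h
  have hφmono : StrictMono φ := fun a b hab => by
    by_contra h
    push Not at h
    have h2 := (strictMono_arclen hg).monotone h
    rw [hφL, hφL] at h2
    exact absurd hab (not_lt.2 h2)
  have hφsurj : Surjective φ := H.symm.surjective
  have hφ0 : φ 0 = 0 := by have := hLφ 0; rwa [arclen_zero] at this
  have hφd : ∀ σ, HasDerivAt φ (1 / Real.sqrt (1 + deriv g (φ σ) ^ 2)) σ := by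
    intro σ
    have hcont : ContinuousAt φ σ := hφcd.continuous.continuousAt
    have hf : HasDerivAt (fun s => ∫ t in (0 : ℝ)..s, Real.sqrt (1 + deriv g t ^ 2)) (Real.sqrt (1 + deriv g (φ σ) ^ 2)) (φ σ) := hasDerivAt_arclen hg (φ σ)
    have h := hf.of_local_left_inverse hcont (speed_pos _).ne' (Filter.Eventually.of_forall hφL)
    simpa [one_div] using h
  exact ⟨φ, hφcd, hφmono, hφsurj, hφL, hLφ, hφ0, hφd⟩

/-! ### 3. The unit-speed branch -/

/-- Derivative of the graph curve: `γ′(s) = e + g′(s)·Je`. -/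
theorem hasDerivAt_graphCurve (e : EuclideanSpace ℝ (Fin 3)) (hg : ContDiff ℝ ∞ g) (s : ℝ) :
    HasDerivAt (fun s : ℝ => s • e + g s • Jvec e) (e + deriv g s • Jvec e) s := by
  have h1 : HasDerivAt (fun s : ℝ => s • e) ((1 : ℝ) • e) s := (hasDerivAt_id s).smul_const e
  have h2 : HasDerivAt (fun s : ℝ => g s • Jvec e) (deriv g s • Jvec e) s :=
    ((hg.differentiable (by simp)) s).hasDerivAt.smul_const (Jvec e)
  have h := h1.add h2
  simp only [one_smul] at h
  exact h

/-- The norm of `a·e + b·Je` for a horizontal unit `e` is `√(a² + b²)`. -/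
theorem norm_frame_comb {e : EuclideanSpace ℝ (Fin 3)} (he2 : e 2 = 0) (hun : ‖e‖ = 1) (a b : ℝ) :
    ‖a • e + b • Jvec e‖ = Real.sqrt (a ^ 2 + b ^ 2) := by
  have hab := sq_add_sq_of_horizontal_unit he2 hun
  have h : ‖a • e + b • Jvec e‖ ^ 2 = a ^ 2 + b ^ 2 := by
    rw [norm_sq_eq_sum3]
    simp [Jvec, he2]
    linear_combination (a ^ 2 + b ^ 2) * hab
  rw [← h, Real.sqrt_sq (norm_nonneg _)]

/-- `rotJ (Jvec e) = −e` for horizontal `e`. -/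
theorem rotJ_Jvec {e : EuclideanSpace ℝ (Fin 3)} (he2 : e 2 = 0) : rotJ (Jvec e) = -e := by
  ext i; fin_cases i <;> simp [rotJ, Jvec, he2]

/-- `rotJ` is linear on combinations: `rotJ (a·e + b·Je) = a·Je − b·e` for horizontal `e`. -/
theorem rotJ_comb {e : EuclideanSpace ℝ (Fin 3)} (he2 : e 2 = 0) (a b : ℝ) : rotJ (a • e + b • Jvec e) = a • Jvec e - b • e := by
  ext i; fin_cases i <;> simp [rotJ, Jvec, he2] <;> ring

/-- `rotJ (c·(e + a·Je)) = c·Je − (c a)·e` for horizontal `e`. -/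
theorem rotJ_smul_comb {e : EuclideanSpace ℝ (Fin 3)} (he2 : e 2 = 0) (c a : ℝ) :
    rotJ (c • (e + a • Jvec e)) = c • Jvec e - (c * a) • e := by
  ext i; fin_cases i <;> simp [rotJ, Jvec, he2] <;> ring

/-- ★ **THE UNIT-SPEED RE-PARAMETRISATION OF A SMOOTH GRAPH OVER THE LINE `ℝe`.**  See the module docstring. -/
theorem exists_unitSpeed_graph {e : EuclideanSpace ℝ (Fin 3)} (he2 : e 2 = 0) (hun : ‖e‖ = 1) (hg : ContDiff ℝ ∞ g) :
    ∃ (Γ : ℝ → EuclideanSpace ℝ (Fin 3)) (φ k : ℝ → ℝ),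
      ContDiff ℝ ∞ Γ ∧ ContDiff ℝ ∞ φ ∧ ContDiff ℝ ∞ k ∧ StrictMono φ ∧ Surjective φ ∧ φ 0 = 0 ∧
      (∀ σ, HasDerivAt φ (1 / Real.sqrt (1 + deriv g (φ σ) ^ 2)) σ) ∧
      (∀ σ, Γ σ = φ σ • e + g (φ σ) • Jvec e) ∧ (∀ σ, Γ σ 2 = 0) ∧
      (∀ σ, deriv Γ σ = (1 / Real.sqrt (1 + deriv g (φ σ) ^ 2)) • (e + deriv g (φ σ) • Jvec e)) ∧ (∀ σ, ‖deriv Γ σ‖ = 1) ∧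
      (∀ σ, k σ = deriv (deriv g) (φ σ) / Real.sqrt (1 + deriv g (φ σ) ^ 2) ^ 3) ∧
      (∀ σ, deriv (deriv Γ) σ = k σ • rotJ (deriv Γ σ)) := by
  obtain ⟨φ, hφcd, hφmono, hφsurj, hφL, hLφ, hφ0, hφd⟩ := exists_arclen_inverse hg
  have hg1 : ContDiff ℝ ∞ (deriv g) := (contDiff_infty_iff_deriv.1 hg).2
  have hg2 : ContDiff ℝ ∞ (deriv (deriv g)) := (contDiff_infty_iff_deriv.1 hg1).2
  have hgd : ∀ s, HasDerivAt g (deriv g s) s := fun s => ((hg.differentiable (by simp)) s).hasDerivAt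
  have hg'd : ∀ s, HasDerivAt (deriv g) (deriv (deriv g) s) s := fun s => ((hg1.differentiable (by simp)) s).hasDerivAt
  set Γ : ℝ → EuclideanSpace ℝ (Fin 3) := fun σ => φ σ • e + g (φ σ) • Jvec e with hΓ
  set k : ℝ → ℝ := fun σ => deriv (deriv g) (φ σ) / Real.sqrt (1 + deriv g (φ σ) ^ 2) ^ 3 with hk
  -- the inverse speed `w = 1/v` and its derivative
  set w : ℝ → ℝ := fun s => 1 / Real.sqrt (1 + deriv g s ^ 2) with hw
  have hv_d : ∀ s, HasDerivAt (fun s => Real.sqrt (1 + deriv g s ^ 2)) (deriv g s * deriv (deriv g) s / Real.sqrt (1 + deriv g s ^ 2)) s := by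
    intro s
    have h1 : HasDerivAt (fun s => 1 + deriv g s ^ 2) (2 * deriv g s * deriv (deriv g) s) s := by
      have h := ((hg'd s).pow 2).const_add 1
      refine h.congr_deriv ?_
      push_cast
      ring
    have h2 := h1.sqrt (one_add_sq_pos s).ne'
    have e1 : (fun y => Real.sqrt (1 + deriv g y ^ 2)) = fun s => Real.sqrt (1 + deriv g s ^ 2) := rfl
    rw [e1] at h2
    refine h2.congr_deriv ?_
    rw [show Real.sqrt (1 + deriv g s ^ 2) = Real.sqrt (1 + deriv g s ^ 2) from rfl, mul_assoc,
      mul_div_mul_left _ _ (two_ne_zero)]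
  have hw_d : ∀ s, HasDerivAt w (-(deriv g s * deriv (deriv g) s) / Real.sqrt (1 + deriv g s ^ 2) ^ 3) s := by
    intro s
    have h := (hv_d s).inv (speed_pos s).ne'
    have e1 : (fun s => Real.sqrt (1 + deriv g s ^ 2))⁻¹ = w := funext fun s => by simp [hw]
    rw [e1] at h
    refine h.congr_deriv ?_
    have hv0 : Real.sqrt (1 + deriv g s ^ 2) ≠ 0 := (speed_pos s).ne'
    field_simp
  -- `Γ′`
  have hΓd : ∀ σ, HasDerivAt Γ ((1 / Real.sqrt (1 + deriv g (φ σ) ^ 2)) • (e + deriv g (φ σ) • Jvec e)) σ := by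
    intro σ
    have hc : HasDerivAt (fun σ => (fun s : ℝ => s • e + g s • Jvec e) (φ σ)) ((1 / Real.sqrt (1 + deriv g (φ σ) ^ 2)) • (e + deriv g (φ σ) • Jvec e)) σ := by
      have h := (hasDerivAt_graphCurve e hg (φ σ)).scomp σ (hφd σ)
      exact h
    exact hc
  have hΓ' : ∀ σ, deriv Γ σ = (1 / Real.sqrt (1 + deriv g (φ σ) ^ 2)) • (e + deriv g (φ σ) • Jvec e) := fun σ => (hΓd σ).deriv
  have hΓunit : ∀ σ, ‖deriv Γ σ‖ = 1 := by
    intro σ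
    rw [hΓ' σ, norm_smul]
    have h1 : ‖e + deriv g (φ σ) • Jvec e‖ = Real.sqrt (1 + deriv g (φ σ) ^ 2) := by
      have h := norm_frame_comb he2 hun 1 (deriv g (φ σ))
      rw [one_smul, one_pow] at h
      exact h
    rw [h1, Real.norm_eq_abs, abs_of_pos (by have := speed_pos (g := g) (φ σ); positivity), one_div,
      inv_mul_cancel₀ (speed_pos _).ne']
  -- `Γ″`: differentiate `σ ↦ w(φσ)·e + (w·g′)(φσ)·Je`
  have hΓ'fun : deriv Γ = fun σ => w (φ σ) • e + (w (φ σ) * deriv g (φ σ)) • Jvec e := by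
    funext σ; rw [hΓ' σ, smul_add, smul_smul]
  have hΓ'' : ∀ σ, deriv (deriv Γ) σ = k σ • rotJ (deriv Γ σ) := by
    intro σ
    set s := φ σ with hs
    have hv0 : Real.sqrt (1 + deriv g s ^ 2) ≠ 0 := (speed_pos s).ne'
    have hv2 := speed_sq (g := g) s
    have hwφ : HasDerivAt (fun σ => w (φ σ)) ((-(deriv g s * deriv (deriv g) s) / Real.sqrt (1 + deriv g s ^ 2) ^ 3) * (1 / Real.sqrt (1 + deriv g s ^ 2))) σ :=
      (hw_d s).comp σ (hφd σ)
    have hwg : HasDerivAt (fun s' => w s' * deriv g s') ((-(deriv g s * deriv (deriv g) s) / Real.sqrt (1 + deriv g s ^ 2) ^ 3) * deriv g s + w s * deriv (deriv g) s) s :=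
      (hw_d s).mul (hg'd s)
    have hwgφ : HasDerivAt (fun σ => w (φ σ) * deriv g (φ σ))
        (((-(deriv g s * deriv (deriv g) s) / Real.sqrt (1 + deriv g s ^ 2) ^ 3) * deriv g s + w s * deriv (deriv g) s) * (1 / Real.sqrt (1 + deriv g s ^ 2))) σ :=
      hwg.comp σ (hφd σ)
    have hsum := (hwφ.smul_const e).add (hwgφ.smul_const (Jvec e))
    have hderiv : deriv (deriv Γ) σ = ((-(deriv g s * deriv (deriv g) s) / Real.sqrt (1 + deriv g s ^ 2) ^ 3) * (1 / Real.sqrt (1 + deriv g s ^ 2))) • e +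
        ((((-(deriv g s * deriv (deriv g) s) / Real.sqrt (1 + deriv g s ^ 2) ^ 3) * deriv g s + w s * deriv (deriv g) s) * (1 / Real.sqrt (1 + deriv g s ^ 2)))) • Jvec e := by
      rw [hΓ'fun]; exact hsum.deriv
    -- the two coefficients
    have hA : (-(deriv g s * deriv (deriv g) s) / Real.sqrt (1 + deriv g s ^ 2) ^ 3) * (1 / Real.sqrt (1 + deriv g s ^ 2)) = -(k σ * (deriv g s / Real.sqrt (1 + deriv g s ^ 2))) := by
      simp only [hk, ← hs]
      field_simp
    have hB : ((-(deriv g s * deriv (deriv g) s) / Real.sqrt (1 + deriv g s ^ 2) ^ 3) * deriv g s + w s * deriv (deriv g) s) * (1 / Real.sqrt (1 + deriv g s ^ 2)) =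
        k σ * (1 / Real.sqrt (1 + deriv g s ^ 2)) := by
      simp only [hk, hw, ← hs]
      field_simp
      linear_combination deriv (deriv g) s * hv2
    rw [hderiv, hA, hB, hΓ' σ, ← hs, rotJ_smul_comb he2]
    simp only [neg_smul, smul_sub, smul_smul]
    module
  -- smoothness
  have hΓcd : ContDiff ℝ ∞ Γ := (hφcd.smul contDiff_const).add ((hg.comp hφcd).smul contDiff_const)
  have hkcd : ContDiff ℝ ∞ k := by
    refine (hg2.comp hφcd).div ((contDiff_speed hg).comp hφcd |>.pow 3) fun σ => ?_
    exact pow_ne_zero 3 (speed_pos _).ne'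
  refine ⟨Γ, φ, k, hΓcd, hφcd, hkcd, hφmono, hφsurj, hφ0, hφd, fun σ => rfl, fun σ => ?_, hΓ', hΓunit, fun σ => rfl, hΓ''⟩
  simp [hΓ, Jvec, he2]

/-! ### 4. Zero curvature pins a bounded graph -/

/-- **If the graph curvature vanishes identically and the graph is bounded, the graph is constant** (`g″ ≡ 0` ⇒ `g′` constant ⇒ bounded affine ⇒
`g′ ≡ 0`). -/
theorem graph_pinned_of_curvature_zero (hg : ContDiff ℝ ∞ g) {r : ℝ} (hb : ∀ s, |g s| ≤ r)
    (hk : ∀ s, deriv (deriv g) s = 0) : ∀ s, g s = g 0 := by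
  have hg1 : ContDiff ℝ ∞ (deriv g) := (contDiff_infty_iff_deriv.1 hg).2
  have hgd : Differentiable ℝ g := hg.differentiable (by simp)
  have hg'd : Differentiable ℝ (deriv g) := hg1.differentiable (by simp)
  -- `g′` is constant
  have hconst : ∀ s, deriv g s = deriv g 0 := fun s =>
    is_const_of_deriv_eq_zero hg'd hk s 0
  -- `g` is affine with slope `deriv g 0`, bounded ⇒ slope `0`
  have hga : ∀ s, HasDerivAt g (deriv g 0) s := fun s => by rw [← hconst s]; exact (hgd s).hasDerivAt
  have hc0 : deriv g 0 = 0 := eq_zero_of_affine_bounded hga hb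
  intro s
  exact is_const_of_deriv_eq_zero hgd (fun s => by rw [hconst s, hc0]) s 0

end Summit.NavierStokesRegularity.NavierStokesRegularity.Theorems.PoloidalWindowDoorLrcModEntireBaseWebArclength

end
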